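import Summits.RiemannHypothesis.RiemannHypothesis.Theorems.HandoffDodgerWitnessDefs
import Summits.RiemannHypothesis.RiemannHypothesis.Theorems.HandoffDodgerTransformComplex
import Literature.NumberTheory.LFunctions.WeilExplicitContinuous
import HarnessLib

/-!
# HANDOFF — the dodger's COEFFICIENTS and the A1-LINK: `‖F̂₀(½ + iξ)‖ = ‖sin bξ‖/(b‖ξ‖) · Π_ρ‖ξ² − z_ρ²‖^{m(ρ)}/Π_k‖ξ² − ℓ_k²‖ · c_∞` (rh-explicit, track «HANDOFF», seat prove-2 gen9, ATTEMPT-18 §3 (R-1))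

HONEST FRAMING. Nothing here bears on the truth of RH. With the killed multiset `zerosBetween 0 T` (`K := N(T)`, ATTEMPT-18 (D-2)) and the dodger
polynomial `P_T` (`HandoffDodgerWitnessDefs`), THIS FILE defines the REAL coefficients `a_j` of the cut-off cosine polynomial
`F₀ = cutoffCosPoly b K a` — `a_{k+1} = Re[(−1)^k P_T(ℓ_{k+1}²)/(2Π_{m≠k}(1 − ℓ_{k+1}²/ℓ_{m+1}²))]`, the bracket being real because `P_T` is
real-valued on `ℝ` (`im_eval_dodgerPoly_ofReal`) — and links the witness to the cost bricks:

* `dodgerCoeffC`, `conj_dodgerCoeffC`, `dodgerCoeff`, `dodgerCoeff_spec` — the coefficients and the hypothesis `ha` of Lemma A1;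
* **`weilMellin_dodger_eq`** — `F̂₀(½ + iξ) = (sin bξ/(bξ))·P_T(ξ²)/Π_{k<K}(1 − ξ²/ℓ_{k+1}²)` off `{0, ±ℓ}` (`HandoffDodgerTransformComplex`);
* **`norm_weilMellin_dodger_eq`** — `‖F̂₀(½ + iξ)‖ = ‖sin bξ‖/(b‖ξ‖) · (Π_ρ‖ξ² − z_ρ²‖^{m(ρ)}/Π_{k<K}‖ξ² − ℓ_{k+1}²‖) · (Π_{k<K}ℓ_{k+1}²/Π_ρ‖z_ρ‖^{2m(ρ)})`
  — the first two factors are exactly what `HandoffDodgerPointwiseCost.pointwise_cost_le` bounds (with `zpow_zeroOrder_eq_pow` for the exponent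
  bookkeeping), the last is the constant `c_∞` of ATTEMPT-16.
No `sorry`, standard axioms.

References: this track (ATTEMPT-16 §1–§2; ATTEMPT-18 §1 (D-3), §3 (R-1)).
-/

set_option linter.dupNamespace false

noncomputable section

open Complex Polynomial Finset
open scoped ComplexConjugate Real

namespace Summit.RiemannHypothesis.RiemannHypothesis.Theorems.Handoff

open Literature.NumberTheory.LFunctions Literature.NumberTheory.LFunctions.SchoenfeldBound

/-! ## The coefficients -/

/-- The complex expression of the `k`-th dodger coefficient: `(−1)^k P_T(ℓ_{k+1}²)/(2Π_{m≠k}(1 − ℓ_{k+1}²/ℓ_{m+1}²))`.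
[this track, ATTEMPT-16 §2] -/
def dodgerCoeffC (b T : ℝ) (K : ℕ) (k : Fin K) : ℂ :=
  (-1) ^ k.val * (dodgerPoly T).eval (((latticeFreq b (k.val + 1)) ^ 2 : ℝ) : ℂ) /
    (2 * ∏ m ∈ univ.erase k, (1 - (((latticeFreq b (k.val + 1)) ^ 2 : ℝ) : ℂ) / (((latticeFreq b (m.val + 1)) ^ 2 : ℝ) : ℂ)))

/-- The dodger coefficients are real. [this track, ATTEMPT-18 (D-3)] -/
theorem conj_dodgerCoeffC (b T : ℝ) (K : ℕ) (k : Fin K) : conj (dodgerCoeffC b T K k) = dodgerCoeffC b T K k := by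
  unfold dodgerCoeffC
  rw [map_div₀, map_mul, map_mul, map_pow, map_neg, map_one, conj_eval_dodgerPoly, map_prod, map_ofNat]
  congr 2
  refine Finset.prod_congr rfl fun m _ => ?_
  rw [map_sub, map_one, map_div₀, Complex.conj_ofReal, Complex.conj_ofReal]

/-- **The dodger coefficients** `a_j` (`1 ≤ j ≤ K`; `0` otherwise), as real numbers. [this track, ATTEMPT-16 §1] -/
def dodgerCoeff (b T : ℝ) (K : ℕ) (j : ℕ) : ℝ :=
  if h : 0 < j ∧ j - 1 < K then (dodgerCoeffC b T K ⟨j - 1, h.2⟩).re else 0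

/-- The coefficients satisfy the hypothesis `ha` of Lemma A1. [this track, ATTEMPT-18 (R-1)] -/
theorem dodgerCoeff_spec (b T : ℝ) (K : ℕ) (k : Fin K) :
    ((dodgerCoeff b T K (k.val + 1) : ℝ) : ℂ) = dodgerCoeffC b T K k := by
  have hk : 0 < k.val + 1 ∧ k.val + 1 - 1 < K := ⟨Nat.succ_pos _, by simp [k.isLt]⟩
  unfold dodgerCoeff
  rw [dif_pos hk]
  have e : (⟨k.val + 1 - 1, hk.2⟩ : Fin K) = k := Fin.ext (by simp)
  rw [e]
  exact Complex.conj_eq_iff_re.1 (conj_dodgerCoeffC b T K k)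

/-! ## The transform of the dodger -/

/-- **The transform of the dodger cut-off** `F₀ = cutoffCosPoly b K (dodgerCoeff b T K)`, `K = N(T)`: off `{0, ±ℓ_1, …, ±ℓ_K}`,
`F̂₀(½ + iξ) = (sin bξ/(bξ))·P_T(ξ²)/Π_{k<K}(1 − ξ²/ℓ_{k+1}²)`. [this track, ATTEMPT-16 Lemma A1; ATTEMPT-18 (R-1)] -/
theorem weilMellin_dodger_eq {b : ℝ} (hb : 0 < b) (T : ℝ) {ξ : ℂ} (hξ : ξ ≠ 0)
    (hξ1 : ∀ k ∈ Finset.range (zetaZeroCount T), ξ + latticeFreq b (k + 1) ≠ 0)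
    (hξ2 : ∀ k ∈ Finset.range (zetaZeroCount T), ξ - latticeFreq b (k + 1) ≠ 0) :
    weilMellin (cutoffCosPoly b (zetaZeroCount T) (dodgerCoeff b T (zetaZeroCount T))) (1 / 2 + I * ξ) =
      Complex.sin (b * ξ) / (b * ξ) *
        ((dodgerPoly T).eval (ξ ^ 2) / ∏ k : Fin (zetaZeroCount T), (1 - ξ ^ 2 / (((latticeFreq b (k.val + 1)) ^ 2 : ℝ) : ℂ))) :=
  weilMellin_cutoffCosPoly_eq_div_complex hb (zetaZeroCount T) (dodgerPoly T) (dodgerPoly_eval_zero T) (natDegree_dodgerPoly_le T)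
    (dodgerCoeff b T (zetaZeroCount T)) (fun k => dodgerCoeff_spec b T _ k) hξ hξ1 hξ2

/-- Exponent bookkeeping: on `zerosBetween 0 T` the multiplicity is non-negative, so `x ^ m(ρ)` (integer power) is `x ^ m(ρ).toNat`. [folklore] -/
theorem zpow_zeroOrder_eq_pow {T : ℝ} {ρ : ℂ} (hρ : ρ ∈ zerosBetween 0 T) (x : ℝ) :
    x ^ riemannZetaZeroOrder ρ = x ^ (riemannZetaZeroOrder ρ).toNat := by
  have h0 : 0 ≤ riemannZetaZeroOrder ρ := by exact_mod_cast zeroOrder_nonneg_of_mem_zerosBetween le_rfl hρ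
  conv_lhs => rw [← Int.toNat_of_nonneg h0]
  exact zpow_natCast x _

/-- **The A1-link in norm form.** Off `{0, ±ℓ}`:
`‖F̂₀(½ + iξ)‖ = ‖sin bξ‖/(b‖ξ‖) · (Π_ρ‖ξ² − z_ρ²‖^{m(ρ)} / Π_{k<K}‖ξ² − ℓ_{k+1}²‖) · (Π_{k<K} ℓ_{k+1}² / Π_ρ ‖z_ρ‖^{2m(ρ)})`.
[this track, ATTEMPT-18 (R-1)] -/
theorem norm_weilMellin_dodger_eq {b : ℝ} (hb : 0 < b) (T : ℝ) {ξ : ℂ} (hξ : ξ ≠ 0)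
    (hξ1 : ∀ k ∈ Finset.range (zetaZeroCount T), ξ + latticeFreq b (k + 1) ≠ 0)
    (hξ2 : ∀ k ∈ Finset.range (zetaZeroCount T), ξ - latticeFreq b (k + 1) ≠ 0) :
    ‖weilMellin (cutoffCosPoly b (zetaZeroCount T) (dodgerCoeff b T (zetaZeroCount T))) (1 / 2 + I * ξ)‖ =
      ‖Complex.sin (b * ξ)‖ / (b * ‖ξ‖) *
        ((∏ ρ ∈ zerosBetween 0 T, ‖ξ ^ 2 - dodgerNode ρ ^ 2‖ ^ (riemannZetaZeroOrder ρ).toNat) /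
          ∏ k ∈ Finset.range (zetaZeroCount T), ‖ξ ^ 2 - ((latticeFreq b (k + 1) : ℝ) : ℂ) ^ 2‖) *
        ((∏ k ∈ Finset.range (zetaZeroCount T), (latticeFreq b (k + 1)) ^ 2) /
          ∏ ρ ∈ zerosBetween 0 T, ‖dodgerNode ρ‖ ^ (2 * (riemannZetaZeroOrder ρ).toNat)) := by
  set K : ℕ := zetaZeroCount T with hK
  rw [weilMellin_dodger_eq hb T hξ hξ1 hξ2, norm_mul, norm_div, norm_div, norm_mul, Complex.norm_real, Real.norm_eq_abs, abs_of_pos hb]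
  -- numerator: `‖P_T(ξ²)‖ = Π ‖ξ² − z_ρ²‖^m / Π ‖z_ρ‖^{2m}`
  have hnum : ‖(dodgerPoly T).eval (ξ ^ 2)‖ =
      (∏ ρ ∈ zerosBetween 0 T, ‖ξ ^ 2 - dodgerNode ρ ^ 2‖ ^ (riemannZetaZeroOrder ρ).toNat) /
        ∏ ρ ∈ zerosBetween 0 T, ‖dodgerNode ρ‖ ^ (2 * (riemannZetaZeroOrder ρ).toNat) := by
    rw [eval_dodgerPoly, norm_prod, ← Finset.prod_div_distrib]
    refine Finset.prod_congr rfl fun ρ hρ => ?_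
    obtain ⟨-, -, -, h3, -⟩ := (mem_zerosBetween le_rfl).1 hρ
    have hn : dodgerNode ρ ^ 2 ≠ 0 := pow_ne_zero 2 (dodgerNode_ne_zero h3.ne')
    rw [norm_pow, one_sub_div hn, norm_div, norm_pow, div_pow, ← pow_mul, norm_sub_rev, mul_comm 2]
  -- denominator: `‖Π(1 − ξ²/ℓ²)‖ = Π‖ξ² − ℓ²‖ / Π ℓ²`
  have hden : ‖∏ k : Fin K, (1 - ξ ^ 2 / (((latticeFreq b (k.val + 1)) ^ 2 : ℝ) : ℂ))‖ =
      (∏ k ∈ Finset.range K, ‖ξ ^ 2 - ((latticeFreq b (k + 1) : ℝ) : ℂ) ^ 2‖) /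
        ∏ k ∈ Finset.range K, (latticeFreq b (k + 1)) ^ 2 := by
    rw [norm_prod, Fin.prod_univ_eq_prod_range (fun k => ‖1 - ξ ^ 2 / (((latticeFreq b (k + 1)) ^ 2 : ℝ) : ℂ)‖) K,
      ← Finset.prod_div_distrib]
    refine Finset.prod_congr rfl fun k _ => ?_
    have hℓ : 0 < latticeFreq b (k + 1) := by unfold latticeFreq; positivity
    have hℓ2 : (((latticeFreq b (k + 1)) ^ 2 : ℝ) : ℂ) ≠ 0 := by exact_mod_cast (pow_pos hℓ 2).ne'
    rw [one_sub_div hℓ2, norm_div, norm_sub_rev, Complex.norm_real, Real.norm_eq_abs, abs_of_pos (pow_pos hℓ 2)]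
    push_cast
    ring
  rw [hnum, hden]
  have hP : 0 < ∏ k ∈ Finset.range K, (latticeFreq b (k + 1)) ^ 2 :=
    Finset.prod_pos fun k _ => by unfold latticeFreq; positivity
  have hZ : 0 < ∏ ρ ∈ zerosBetween 0 T, ‖dodgerNode ρ‖ ^ (2 * (riemannZetaZeroOrder ρ).toNat) :=
    Finset.prod_pos fun ρ hρ => by
      obtain ⟨-, -, -, h3, -⟩ := (mem_zerosBetween le_rfl).1 hρ
      exact pow_pos (norm_pos_iff.2 (dodgerNode_ne_zero h3.ne')) _
  field_simp

/-! ## Merged part: HANDOFF — the dodger's transform AT THE ZEROS of `ζ`, and realness of the witness (rh-explicit, track «HANDOFF», seat prove-2 gen9, ATTEMPT-18 §3 (R-2) glue)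

(Originally a separate file of this track; its module docstring is kept with the HOME copy. Nothing here bears on the truth of RH.) -/

open Complex Finset MeasureTheory

/-! ## The transform at a zero -/

/-- The node of a point of the closed upper strip (`Im ρ > 0`) is off `0` and off the negatives of the lattice. [folklore] -/
theorem dodgerNode_lattice_conditions {b : ℝ} (hb : 0 < b) {K : ℕ} {ρ : ℂ} (hρ : 0 < ρ.im) :
    dodgerNode ρ ≠ 0 ∧ ∀ k ∈ Finset.range K, dodgerNode ρ + latticeFreq b (k + 1) ≠ 0 := by
  refine ⟨dodgerNode_ne_zero hρ.ne', fun k _ h => ?_⟩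
  have := congrArg Complex.re h
  simp only [Complex.add_re, dodgerNode_re, Complex.ofReal_re, Complex.zero_re] at this
  have hℓ : 0 < latticeFreq b (k + 1) := by unfold latticeFreq; positivity
  linarith

/-- **A killed zero is a zero of the dodger's transform**: for `ρ ∈ zerosBetween 0 T` with `z_ρ ∉ {ℓ_1, …, ℓ_K}` (`K = N(T)`),
`F̂₀(ρ) = 0`. [this track, ATTEMPT-18 (R-2)] -/
theorem weilMellin_dodger_zero_of_killed {b T : ℝ} (hb : 0 < b) {ρ : ℂ} (hρ : ρ ∈ zerosBetween 0 T)
    (hgen : ∀ k ∈ Finset.range (zetaZeroCount T), dodgerNode ρ - latticeFreq b (k + 1) ≠ 0) :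
    weilMellin (cutoffCosPoly b (zetaZeroCount T) (dodgerCoeff b T (zetaZeroCount T))) ρ = 0 := by
  obtain ⟨-, -, -, h3, -⟩ := (mem_zerosBetween le_rfl).1 hρ
  obtain ⟨h0, h1⟩ := dodgerNode_lattice_conditions (K := zetaZeroCount T) hb h3
  conv_lhs => rw [← half_add_I_mul_dodgerNode ρ]
  rw [weilMellin_dodger_eq hb T h0 h1 hgen, dodgerPoly_eval_node_sq hρ, zero_div, mul_zero]

/-- **The transform at any zero off the lattice**, in norm form (`ρ = ½ + i z_ρ`). [this track, ATTEMPT-18 (R-2)] -/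
theorem norm_weilMellin_dodger_at_zero {b T : ℝ} (hb : 0 < b) {ρ : ℂ} (hρ : 0 < ρ.im)
    (hgen : ∀ k ∈ Finset.range (zetaZeroCount T), dodgerNode ρ - latticeFreq b (k + 1) ≠ 0) :
    ‖weilMellin (cutoffCosPoly b (zetaZeroCount T) (dodgerCoeff b T (zetaZeroCount T))) ρ‖ =
      ‖Complex.sin (b * dodgerNode ρ)‖ / (b * ‖dodgerNode ρ‖) *
        ((∏ ρ' ∈ zerosBetween 0 T, ‖dodgerNode ρ ^ 2 - dodgerNode ρ' ^ 2‖ ^ (riemannZetaZeroOrder ρ').toNat) /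
          ∏ k ∈ Finset.range (zetaZeroCount T), ‖dodgerNode ρ ^ 2 - ((latticeFreq b (k + 1) : ℝ) : ℂ) ^ 2‖) *
        ((∏ k ∈ Finset.range (zetaZeroCount T), (latticeFreq b (k + 1)) ^ 2) /
          ∏ ρ' ∈ zerosBetween 0 T, ‖dodgerNode ρ'‖ ^ (2 * (riemannZetaZeroOrder ρ').toNat)) := by
  obtain ⟨h0, h1⟩ := dodgerNode_lattice_conditions (K := zetaZeroCount T) hb hρ
  conv_lhs => rw [← half_add_I_mul_dodgerNode ρ]
  exact norm_weilMellin_dodger_eq hb T h0 h1 hgen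

/-! ## Realness of the witness -/

/-- The cut-off cosine polynomial is real-valued. [folklore] -/
theorem im_cutoffCosPoly (b : ℝ) (K : ℕ) (a : ℕ → ℝ) (t : ℝ) : (cutoffCosPoly b K a t).im = 0 := by
  unfold cutoffCosPoly
  by_cases h : t ∈ Set.Icc (-b) b
  · rw [Set.indicator_of_mem h, Complex.ofReal_im]
  · rw [Set.indicator_of_notMem h, Complex.zero_im]

/-- The convolution of two real-valued functions is real-valued. [folklore] -/
theorem im_weilConv_of_im_eq_zero {F φ : ℝ → ℂ} (hF : ∀ t, (F t).im = 0) (hφ : ∀ t, (φ t).im = 0) (x : ℝ) :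
    (weilConv F φ x).im = 0 := by
  rw [weilConv_apply]
  have e : (fun u : ℝ => F u * φ (x - u)) = fun u : ℝ => (((F u).re * (φ (x - u)).re : ℝ) : ℂ) := by
    funext u
    apply Complex.ext
    · simp [Complex.mul_re, hF u, hφ (x - u)]
    · simp [Complex.mul_im, hF u, hφ (x - u)]
  rw [e, integral_complex_ofReal, Complex.ofReal_im]

/-- The mollifiers `moll k` are real-valued. [folklore] -/
theorem im_moll (k : ℕ) (x : ℝ) : (WeilContinuous.moll k x).im = 0 := by
  obtain ⟨r, -, hr⟩ := WeilContinuous.moll_eq_ofReal_nonneg k x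
  rw [hr, Complex.ofReal_im]

/-- The translate pair of a real-valued function is real-valued. [folklore] -/
theorem im_translatePair {θ : ℝ → ℂ} (hθ : ∀ t, (θ t).im = 0) (δ x : ℝ) : (θ (x - δ) - θ (x + δ)).im = 0 := by
  rw [Complex.sub_im, hθ, hθ, sub_zero]

/-- **The dodger witness is real**: `G_δ = θ(·−δ) − θ(·+δ)`, `θ = F₀ ⋆ moll k`, `F₀` the dodger cut-off. [this track, ATTEMPT-18 (R-2)] -/
theorem im_dodgerWitness (b T : ℝ) (k : ℕ) (δ x : ℝ) :
    (weilConv (cutoffCosPoly b (zetaZeroCount T) (dodgerCoeff b T (zetaZeroCount T))) (WeilContinuous.moll k) (x - δ) -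
      weilConv (cutoffCosPoly b (zetaZeroCount T) (dodgerCoeff b T (zetaZeroCount T))) (WeilContinuous.moll k) (x + δ)).im = 0 :=
  im_translatePair (fun t => im_weilConv_of_im_eq_zero (im_cutoffCosPoly b _ _) (im_moll k) t) δ x

end Summit.RiemannHypothesis.RiemannHypothesis.Theorems.Handoff

end
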